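import Literature.Topology.FourManifolds.KirbyMovesSlideEndThickeningChart
import Literature.Topology.FourManifolds.StraightLineIsotopyExtension
import Literature.Topology.FourManifolds.RadialSaturation
import HarnessLib

/-!
# Normalising the band end: the thickening is a chart of `S³` near the attaching arc

Topic `Literature/Topology/FourManifolds`; fact seat `provefact-IsStrictHandleSlide.isSurgery`
(R. C. Kirby, *The Topology of 4-Manifolds*, LNM 1374 (1989), Ch. I §4; remaining content: the
named fact (S) `Literature.Topology.FourManifolds.FramedLink.IsStrictHandleSlide.slideModel`).
The thickening of the band end read in a chart `σ` of `S³`, `f = σ ∘ thickening`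
(`KirbyMovesSlideEndThickeningChart.lean`), is an injective local diffeomorphism on a
neighbourhood of the compact edge segment `{((1, y), 0) : h₁ ≤ y ≤ h₂}` once the band leaves
the push-off radially along it; hence it has a smooth inverse on an open neighbourhood there
(Lee, *Introduction to Smooth Manifolds* (2013), Prop. 5.7 via the tree's
`exists_isOpen_injOn_of_isCompact` and `exists_openPartialHomeomorph_of_forall_hasFDerivAt`).
Proved here (no definitions, no named facts):

* `BandCore.injOn_thickeningChart_segment` — `f` is injective on the edge segment
  (`f ((1, y), 0) = σ (Kⱼ' (circlePt (thetaB y)))`, `thetaB` strictly monotone with window `< 1`);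
* `BandCore.exists_thickeningChart_inverse` — an open `N ⊇ segment` inside `baseLiftDom × ℝ` and
  an open partial homeomorphism `Φ = f` with source `N`, open target `f '' N` and `C^∞` inverse.

## References

* R. C. Kirby, *The Topology of 4-Manifolds*, LNM 1374, Springer (1989), Ch. I §4. [Kirby1989]
* J. M. Lee, *Introduction to Smooth Manifolds*, 2nd ed., GTM 218 (2013), Thm. 4.5, Prop. 5.7. [Lee2013]
-/

open scoped Manifold ContDiff Topology
open Function Set Metric

noncomputable section

namespace Literature.Topology.FourManifolds

namespace BandCore

variable [Knot.TubularNbhd.SmoothnessFacts] {A Kj : Knot} (ν : Knot.TubularNbhd Kj)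
  {avoid : Set (Metric.sphere (0 : EuclideanSpace ℝ (Fin 4)) 1)} (b : BandCore A ν.pushOff avoid)
  {σ : OpenPartialHomeomorph (Metric.sphere (0 : EuclideanSpace ℝ (Fin 4)) 1) (EuclideanSpace ℝ (Fin 3))}

/-- **`thetaB` takes distinct values at distinct heights, even modulo `1`**: for
`y, y' ∈ [1/10, 9/10]` with `circlePt (thetaB y) = circlePt (thetaB y')`, `y = y'`. [folklore] -/
theorem eq_of_circlePt_thetaB_eq {y y' : ℝ} (hy : y ∈ Icc (10⁻¹ : ℝ) (9 / 10)) (hy' : y' ∈ Icc (10⁻¹ : ℝ) (9 / 10))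
    (h : circlePt (b.thetaB y) = circlePt (b.thetaB y')) : y = y' := by
  obtain ⟨m, hm⟩ := circlePt_eq_circlePt_iff.1 h
  have hanti := b.strictAntiOn_thetaB
  have hwin := b.thetaB_window
  have h1 : b.thetaB (9 / 10) ≤ b.thetaB y := hanti.antitoneOn hy ⟨by norm_num, by norm_num⟩ hy.2
  have h2 : b.thetaB y ≤ b.thetaB 10⁻¹ := hanti.antitoneOn ⟨by norm_num, by norm_num⟩ hy hy.1
  have h1' : b.thetaB (9 / 10) ≤ b.thetaB y' := hanti.antitoneOn hy' ⟨by norm_num, by norm_num⟩ hy'.2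
  have h2' : b.thetaB y' ≤ b.thetaB 10⁻¹ := hanti.antitoneOn ⟨by norm_num, by norm_num⟩ hy' hy'.1
  have hm1 : (m : ℝ) < 1 := by linarith
  have hm2 : (-1 : ℝ) < m := by linarith
  have hm1' : m < 1 := by exact_mod_cast hm1
  have hm2' : -1 < m := by exact_mod_cast hm2
  obtain rfl : m = 0 := by omega
  simp only [Int.cast_zero, add_zero] at hm
  exact hanti.injOn hy hy' hm

/-- **The thickening in the chart is injective on the edge segment.** [folklore] -/
theorem injOn_thickeningChart_segment (hνσ : ∀ q, ν q ∈ σ.source) {h₁ h₂ : ℝ} (hh₁ : 10⁻¹ < h₁) (hh₂ : h₂ < 9 / 10) :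
    InjOn (fun p : EuclideanSpace ℝ (Fin 2) × ℝ ↦ σ (b.thickening ν p))
      ((fun y : ℝ ↦ ((pt2 1 y : EuclideanSpace ℝ (Fin 2)), (0 : ℝ))) '' Icc h₁ h₂) := by
  rintro _ ⟨y, hy, rfl⟩ _ ⟨y', hy', rfl⟩ h
  have hyc : y ∈ Icc (10⁻¹ : ℝ) (9 / 10) := ⟨by linarith [hy.1], by linarith [hy.2]⟩
  have hyc' : y' ∈ Icc (10⁻¹ : ℝ) (9 / 10) := ⟨by linarith [hy'.1], by linarith [hy'.2]⟩
  simp only [b.thickening_pt2_one_zero ν hyc, b.thickening_pt2_one_zero ν hyc'] at h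
  have h2 : ν (circlePt (b.thetaB y), framingBaseVector) = ν (circlePt (b.thetaB y'), framingBaseVector) :=
    σ.injOn (hνσ _) (hνσ _) (by simpa [Knot.TubularNbhd.pushOff_apply] using h)
  have h3 : circlePt (b.thetaB y) = circlePt (b.thetaB y') := congrArg Prod.fst (ν.injective h2)
  have := b.eq_of_circlePt_thetaB_eq ν hyc hyc' h3
  subst this
  rfl

/-- **The thickening is a chart of `S³` near the edge segment.** Let `σ` be a chart of `S³` to
`ℝ³` (smooth with smooth inverse) containing `ν (S¹ × ℝ²)`, and suppose the band leaves the
push-off radially along `[h₁, h₂] ⊆ (1/10, 9/10)`: `D W (1, y) (1, 0) = -c(y) • e₀`, `c(y) ≠ 0`.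
Then there are an open `N` with `segment ⊆ N ⊆ baseLiftDom × ℝ` and an open partial
homeomorphism `Φ` with `⇑Φ = σ ∘ thickening`, `Φ.source = N`, `Φ.target = (σ ∘ thickening) '' N`
open, and `Φ.symm` of class `C^∞` on the target. [cite: Lee2013, Prop. 5.7] -/
theorem exists_thickeningChart_inverse (hσ : ContMDiffOn (𝓡 3) 𝓘(ℝ, EuclideanSpace ℝ (Fin 3)) ∞ σ σ.source)
    (hσs : ContMDiff 𝓘(ℝ, EuclideanSpace ℝ (Fin 3)) (𝓡 3) ∞ σ.symm) (hνσ : ∀ q, ν q ∈ σ.source)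
    {h₁ h₂ : ℝ} (hh₁ : 10⁻¹ < h₁) (hh₂ : h₂ < 9 / 10) {c : ℝ → ℝ} (hc : ∀ y ∈ Icc h₁ h₂, c y ≠ 0)
    (hA : ∀ y ∈ Icc h₁ h₂, fderiv ℝ (b.tubeNormal ν) (pt2 1 y) (pt2 1 0) = (-c y) • framingBaseVector) :
    ∃ (N : Set (EuclideanSpace ℝ (Fin 2) × ℝ)) (Φ : OpenPartialHomeomorph (EuclideanSpace ℝ (Fin 2) × ℝ) (EuclideanSpace ℝ (Fin 3))),
      IsOpen N ∧ (fun y : ℝ ↦ ((pt2 1 y : EuclideanSpace ℝ (Fin 2)), (0 : ℝ))) '' Icc h₁ h₂ ⊆ N ∧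
      N ⊆ (b.baseLiftDom ν) ×ˢ univ ∧
      ⇑Φ = (fun p : EuclideanSpace ℝ (Fin 2) × ℝ ↦ σ (b.thickening ν p)) ∧ Φ.source = N ∧
      Φ.target = (fun p : EuclideanSpace ℝ (Fin 2) × ℝ ↦ σ (b.thickening ν p)) '' N ∧
      IsOpen ((fun p : EuclideanSpace ℝ (Fin 2) × ℝ ↦ σ (b.thickening ν p)) '' N) ∧
      ContDiffOn ℝ ∞ Φ.symm ((fun p : EuclideanSpace ℝ (Fin 2) × ℝ ↦ σ (b.thickening ν p)) '' N) := by
  obtain ⟨f, hf⟩ : ∃ f : EuclideanSpace ℝ (Fin 2) × ℝ → EuclideanSpace ℝ (Fin 3),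
      f = fun p ↦ σ (b.thickening ν p) := ⟨_, rfl⟩
  set D : Set (EuclideanSpace ℝ (Fin 2) × ℝ) := (b.baseLiftDom ν) ×ˢ univ with hD
  have hDo : IsOpen D := (b.isOpen_baseLiftDom' ν).prod isOpen_univ
  have hfD : ContDiffOn ℝ ∞ f D := by rw [hf]; exact b.contDiffOn_thickeningChart ν hσ hνσ
  set K : Set (EuclideanSpace ℝ (Fin 2) × ℝ) := (fun y : ℝ ↦ ((pt2 1 y : EuclideanSpace ℝ (Fin 2)), (0 : ℝ))) '' Icc h₁ h₂ with hK
  have hline : ContDiff ℝ ∞ (fun y : ℝ ↦ (pt2 1 y : EuclideanSpace ℝ (Fin 2))) := by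
    rw [contDiff_euclidean]
    intro i; fin_cases i
    · exact contDiff_const
    · exact contDiff_id
  have hKc : IsCompact K := isCompact_Icc.image (hline.continuous.prodMk continuous_const)
  have hyI : ∀ y ∈ Icc h₁ h₂, y ∈ Ioo (10⁻¹ : ℝ) (9 / 10) := fun y hy ↦ ⟨by linarith [hy.1], by linarith [hy.2]⟩
  have hKD : K ⊆ D := by
    rintro _ ⟨y, hy, rfl⟩
    exact ⟨b.pt2_one_mem_baseLiftDom' ν (hyI y hy), mem_univ _⟩
  -- equivalence derivatives along the segment
  have hderivK : ∀ p ∈ K, ∃ L : (EuclideanSpace ℝ (Fin 2) × ℝ) ≃L[ℝ] EuclideanSpace ℝ (Fin 3),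
      HasFDerivAt f (L : (EuclideanSpace ℝ (Fin 2) × ℝ) →L[ℝ] EuclideanSpace ℝ (Fin 3)) p := by
    rintro _ ⟨y, hy, rfl⟩
    rw [hf]
    exact b.exists_equiv_hasFDerivAt_thickeningChart ν hσ hσs hνσ (hyI y hy) (hc y hy) (hA y hy)
  -- local injectivity near the segment (inverse function theorem)
  have hloc : ∀ p ∈ K, ∃ V ∈ 𝓝 p, InjOn f V := by
    intro p hp
    obtain ⟨L, hL⟩ := hderivK p hp
    have hfp : ContDiffAt ℝ ∞ f p := hfD.contDiffAt (hDo.mem_nhds (hKD hp))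
    set Ψ := hfp.toOpenPartialHomeomorph f hL (by simp) with hΨ
    refine ⟨Ψ.source, Ψ.open_source.mem_nhds (hfp.mem_toOpenPartialHomeomorph_source hL (by simp)), ?_⟩
    have : InjOn Ψ Ψ.source := Ψ.injOn
    simpa [hΨ] using this
  -- injectivity on a neighbourhood of the segment
  have hinjK : InjOn f K := by rw [hf]; exact b.injOn_thickeningChart_segment ν hνσ hh₁ hh₂
  obtain ⟨V, hVo, hKV, hVinj⟩ := exists_isOpen_injOn_of_isCompact hKc
    (fun p hp ↦ (hfD.contDiffAt (hDo.mem_nhds (hKD hp))).continuousAt) hinjK hloc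
  -- the open set where the derivative is invertible
  set S : Set (EuclideanSpace ℝ (Fin 2) × ℝ) := D ∩ fderiv ℝ f ⁻¹'
    range ((↑) : ((EuclideanSpace ℝ (Fin 2) × ℝ) ≃L[ℝ] EuclideanSpace ℝ (Fin 3)) →
      (EuclideanSpace ℝ (Fin 2) × ℝ) →L[ℝ] EuclideanSpace ℝ (Fin 3)) with hS
  have hSo : IsOpen S :=
    (hfD.continuousOn_fderiv_of_isOpen hDo (by simp)).isOpen_inter_preimage hDo ContinuousLinearEquiv.isOpen
  have hKS : K ⊆ S := fun p hp ↦ by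
    obtain ⟨L, hL⟩ := hderivK p hp
    exact ⟨hKD hp, ⟨L, hL.fderiv.symm⟩⟩
  -- the neighbourhood `N`
  set N : Set (EuclideanSpace ℝ (Fin 2) × ℝ) := V ∩ S with hN
  have hNo : IsOpen N := hVo.inter hSo
  have hKN : K ⊆ N := subset_inter hKV hKS
  have hND : N ⊆ D := fun p hp ↦ hp.2.1
  have hfN : ContDiffOn ℝ ∞ f N := hfD.mono hND
  have hinjN : InjOn f N := hVinj.mono inter_subset_left
  have hderivN : ∀ p ∈ N, ∃ L : (EuclideanSpace ℝ (Fin 2) × ℝ) ≃L[ℝ] EuclideanSpace ℝ (Fin 3),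
      HasFDerivAt f (L : (EuclideanSpace ℝ (Fin 2) × ℝ) →L[ℝ] EuclideanSpace ℝ (Fin 3)) p := by
    intro p hp
    obtain ⟨L, hL⟩ := hp.2.2
    refine ⟨L, ?_⟩
    rw [hL]
    exact ((hfD.contDiffAt (hDo.mem_nhds hp.2.1)).differentiableAt (by simp)).hasFDerivAt
  obtain ⟨Φ, hΦf, hΦs, hΦt, hopen, hsymm⟩ :=
    exists_openPartialHomeomorph_of_forall_hasFDerivAt hNo hfN hinjN hderivN
  refine ⟨N, Φ, hNo, hKN, hND, ?_, hΦs, ?_, ?_, ?_⟩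
  · rw [hΦf, hf]
  · rw [hΦt, hf]
  · rw [← hf]; exact hopen
  · rw [← hf]; exact hsymm

end BandCore

end Literature.Topology.FourManifolds
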